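import Literature.Probability.Process.RenewalTheorem
import HarnessLib

/-!
# An explicit geometric rate in the discrete renewal theorem (majorant form)

Topic `Literature/Probability/Process`, continuing `RenewalTheorem.lean` (same conventions: nonnegative `f : ℕ → ℝ`,
`f₀ = 0`, `Σ f = 1`, `u₀ = 1`, renewal equation `uₙ = Σ_{k ≤ n} f_k u_{n-k}` for `n ≥ 1`, tail sums
`r_n = 1 - Σ_{k ≤ n} f_k`; here `0 ≤ u ≤ 1` is NOT needed).

Source for the qualitative statement: N. Madras, G. Slade, *The Self-Avoiding Walk* (1993; 2013 reprint pagination),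
Theorem 4.2.5 (p. 95, lines 18–22 of the held scan p0110): for the renewal structure of bridges by irreducible bridges,
"`|B_z(L) e^{m(z)L} - C_z| ≤ e^{-ε(z)L}` for some `ε(z) > 0`", proved there by a residue / analytic-continuation
argument with an INEXPLICIT `ε(z)`; and Appendix B, (B.5): `Σ_{k ≤ n} r_k u_{n-k} = 1`.

What is typed here is an EXPLICIT, finitely-checkable version for an abstract renewal pair (new in this form; elementary):

**Theorem (`abs_sub_inv_mul_pow_le`).** Let `m > 0` dominate the partial sums `Σ_{k ≤ n} r_k` (e.g. `m = Σ k f_k`, the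
mean) and put `T_n := m - Σ_{k ≤ n} r_k ≥ 0`. If `ρ > 0`, `Σ_{1 ≤ k ≤ n} r_k ρ^k ≤ G < 1` and `T_n ρ^n ≤ D` for all
`n`, then for EVERY `n`: `|uₙ - 1/m| · ρ^n ≤ D / (m (1 - G))`.

Proof: (B.5) twisted by `1/m` reads `Σ_{k ≤ n} r_k (u_{n-k} - 1/m) = T_n / m` (`sum_tailSum_mul_sub_inv`); peel `k = 0`
(`r₀ = 1`) and run a strong induction on the majorant recursion `wₙ ≤ T_n ρ^n / m + Σ_{k ≥ 1} (r_k ρ^k) w_{n-k}`.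

**Series form (`abs_sub_inv_tsum_le`).** With `m = Σ k f_k < ∞`, `ρ ≥ 1`, `G = Σ_{j ≥ 1} r_j ρ^j < 1` and
`H = Σ_{j ≥ 1} r_j (1 + ρ + ⋯ + ρ^{j-1})`: `|uₙ - 1/m| ≤ H / (m (1 - G)) · ρ^{-n}` (take `D = H`, since
`T_n ρ^n = Σ_{k > n} r_k ρ^n ≤ Σ_{k > n} r_k (1 + ⋯ + ρ^{k-1})`).

Use (lane pcv-sawmu, ROUTES-G8 R35.8): with `uₙ = Z^B_n(y) e^{-nλ_B(y)}` and `f` = the block law of irreducible pulled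
bridges, certified values of `G, H` (census + tail envelope) give an explicit exponential rate in the Ornstein–Zernike
asymptotics of pulled bridges.
-/

noncomputable section

open Finset

namespace Literature.Probability.Process.Renewal


variable {u f r : ℕ → ℝ}

/-- Twisted conservation law: `Σ_{k ≤ n} r_k (u_{n-k} - m⁻¹) = (m - Σ_{k ≤ n} r_k) / m` ((B.5) minus `(1/m)·Σ_{k ≤ n} r_k`).
[cite: MadrasSlade1993, Appendix B, (B.5)] -/
theorem sum_tailSum_mul_sub_inv
    (hr : ∀ n, r n = 1 - ∑ k ∈ range (n + 1), f k) (hu0 : u 0 = 1) (hf0 : f 0 = 0)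
    (hren : ∀ n, 1 ≤ n → u n = ∑ k ∈ range (n + 1), f k * u (n - k)) {m : ℝ} (hm : m ≠ 0) (n : ℕ) :
    ∑ k ∈ range (n + 1), r k * (u (n - k) - m⁻¹) = (m - ∑ k ∈ range (n + 1), r k) / m := by
  have h := sum_tailSum_mul_eq_one hr hu0 hf0 hren n
  have : ∑ k ∈ range (n + 1), r k * (u (n - k) - m⁻¹)
      = ∑ k ∈ range (n + 1), r k * u (n - k) - (∑ k ∈ range (n + 1), r k) * m⁻¹ := by
    rw [Finset.sum_mul, ← Finset.sum_sub_distrib]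
    refine Finset.sum_congr rfl fun k _ => by ring
  rw [this, h]
  field_simp

/-- **Explicit geometric rate in the renewal theorem (finitary majorant form; NOT printed in this form — the printed
statement is the inexplicit `∃ ε(z) > 0` of Madras–Slade Theorem 4.2.5, p. 95).** If `Σ_{1 ≤ k ≤ n} r_k ρ^k ≤ G < 1` and
`(m - Σ_{k ≤ n} r_k) ρ^n ≤ D` for all `n`, then `|uₙ - m⁻¹| ρ^n ≤ D / (m (1 - G))` for every `n`.
[cite: MadrasSlade1993, Theorem 4.2.5 and Appendix B] -/
theorem abs_sub_inv_mul_pow_le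
    (hr : ∀ n, r n = 1 - ∑ k ∈ range (n + 1), f k) (hu0 : u 0 = 1) (hf : ∀ k, 0 ≤ f k) (hf0 : f 0 = 0)
    (hren : ∀ n, 1 ≤ n → u n = ∑ k ∈ range (n + 1), f k * u (n - k)) (hf1 : HasSum f 1)
    {m ρ G D : ℝ} (hm : 0 < m) (hmge : ∀ n, ∑ k ∈ range (n + 1), r k ≤ m) (hρ : 0 < ρ) (hG1 : G < 1)
    (hG : ∀ n, ∑ k ∈ range n, r (k + 1) * ρ ^ (k + 1) ≤ G)
    (hD : ∀ n, (m - ∑ k ∈ range (n + 1), r k) * ρ ^ n ≤ D) :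
    ∀ n, |u n - m⁻¹| * ρ ^ n ≤ D / (m * (1 - G)) := by
  have hr0 : r 0 = 1 := tailSum_zero hr hf0
  have hrnn : ∀ k, 0 ≤ r k := fun k => tailSum_nonneg hr hf hf1 k
  have hG0 : 0 ≤ G := by simpa using hG 0
  have h1G : 0 < 1 - G := by linarith
  have hD0 : 0 ≤ D := by
    have h := hD 0
    have h' := hmge 0
    simp [hr0] at h h'
    nlinarith
  set C := D / (m * (1 - G)) with hC
  have hC0 : 0 ≤ C := div_nonneg hD0 (mul_pos hm h1G).le
  have hCD : D / m = C * (1 - G) := by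
    rw [hC]; field_simp
  intro n
  induction n using Nat.strong_induction_on with
  | _ n ih =>
    have htw := sum_tailSum_mul_sub_inv hr hu0 hf0 hren hm.ne' n
    rw [Finset.sum_range_succ'] at htw
    simp only [Nat.sub_zero, hr0, one_mul] at htw
    set T := m - ∑ k ∈ range (n + 1), r k with hT
    have hT0 : 0 ≤ T := by have := hmge n; linarith
    set S := ∑ k ∈ range n, r (k + 1) * (u (n - (k + 1)) - m⁻¹) with hS
    have hv : u n - m⁻¹ = T / m - S := by linarith
    -- |S| ≤ Σ r_{k+1} |v_{n-k-1}|
    have hSabs : |S| ≤ ∑ k ∈ range n, r (k + 1) * |u (n - (k + 1)) - m⁻¹| := by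
      calc |S| ≤ ∑ k ∈ range n, |r (k + 1) * (u (n - (k + 1)) - m⁻¹)| := Finset.abs_sum_le_sum_abs _ _
        _ = ∑ k ∈ range n, r (k + 1) * |u (n - (k + 1)) - m⁻¹| := by
            refine Finset.sum_congr rfl fun k _ => ?_
            rw [abs_mul, abs_of_nonneg (hrnn _)]
    have habs : |u n - m⁻¹| ≤ T / m + ∑ k ∈ range n, r (k + 1) * |u (n - (k + 1)) - m⁻¹| := by
      rw [hv]
      calc |T / m - S| ≤ |T / m| + |S| := abs_sub _ _
        _ ≤ T / m + ∑ k ∈ range n, r (k + 1) * |u (n - (k + 1)) - m⁻¹| := by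
            rw [abs_of_nonneg (div_nonneg hT0 hm.le)]; linarith
    -- multiply by ρ^n and use the induction hypothesis termwise
    have hρn : 0 ≤ ρ ^ n := pow_nonneg hρ.le n
    have hsum : (∑ k ∈ range n, r (k + 1) * |u (n - (k + 1)) - m⁻¹|) * ρ ^ n ≤ C * G := by
      rw [Finset.sum_mul]
      have hterm : ∀ k ∈ range n,
          r (k + 1) * |u (n - (k + 1)) - m⁻¹| * ρ ^ n ≤ C * (r (k + 1) * ρ ^ (k + 1)) := by
        intro k hk
        have hkn : k + 1 ≤ n := Nat.succ_le_of_lt (Finset.mem_range.1 hk)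
        have hsplit : ρ ^ n = ρ ^ (k + 1) * ρ ^ (n - (k + 1)) := by
          rw [← pow_add, Nat.add_sub_cancel' hkn]
        have hih : |u (n - (k + 1)) - m⁻¹| * ρ ^ (n - (k + 1)) ≤ C := ih _ (by omega)
        have hrk : 0 ≤ r (k + 1) * ρ ^ (k + 1) := mul_nonneg (hrnn _) (pow_nonneg hρ.le _)
        calc r (k + 1) * |u (n - (k + 1)) - m⁻¹| * ρ ^ n
            = (r (k + 1) * ρ ^ (k + 1)) * (|u (n - (k + 1)) - m⁻¹| * ρ ^ (n - (k + 1))) := by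
              rw [hsplit]; ring
          _ ≤ (r (k + 1) * ρ ^ (k + 1)) * C := mul_le_mul_of_nonneg_left hih hrk
          _ = C * (r (k + 1) * ρ ^ (k + 1)) := by ring
      calc ∑ k ∈ range n, r (k + 1) * |u (n - (k + 1)) - m⁻¹| * ρ ^ n
          ≤ ∑ k ∈ range n, C * (r (k + 1) * ρ ^ (k + 1)) := Finset.sum_le_sum hterm
        _ = C * ∑ k ∈ range n, r (k + 1) * ρ ^ (k + 1) := by rw [Finset.mul_sum]
        _ ≤ C * G := mul_le_mul_of_nonneg_left (hG n) hC0
    have hTD : T / m * ρ ^ n ≤ D / m := by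
      rw [div_mul_eq_mul_div]
      exact div_le_div_of_nonneg_right (hD n) hm.le
    calc |u n - m⁻¹| * ρ ^ n
        ≤ (T / m + ∑ k ∈ range n, r (k + 1) * |u (n - (k + 1)) - m⁻¹|) * ρ ^ n :=
          mul_le_mul_of_nonneg_right habs hρn
      _ = T / m * ρ ^ n + (∑ k ∈ range n, r (k + 1) * |u (n - (k + 1)) - m⁻¹|) * ρ ^ n := by ring
      _ ≤ D / m + C * G := add_le_add hTD hsum
      _ = C := by rw [hCD]; ring

/-- The same bound in the form `|uₙ - m⁻¹| ≤ D/(m(1-G)) · ρ⁻¹ ^ n`. [cite: MadrasSlade1993, Theorem 4.2.5] -/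
theorem abs_sub_inv_le
    (hr : ∀ n, r n = 1 - ∑ k ∈ range (n + 1), f k) (hu0 : u 0 = 1) (hf : ∀ k, 0 ≤ f k) (hf0 : f 0 = 0)
    (hren : ∀ n, 1 ≤ n → u n = ∑ k ∈ range (n + 1), f k * u (n - k)) (hf1 : HasSum f 1)
    {m ρ G D : ℝ} (hm : 0 < m) (hmge : ∀ n, ∑ k ∈ range (n + 1), r k ≤ m) (hρ : 0 < ρ) (hG1 : G < 1)
    (hG : ∀ n, ∑ k ∈ range n, r (k + 1) * ρ ^ (k + 1) ≤ G)
    (hD : ∀ n, (m - ∑ k ∈ range (n + 1), r k) * ρ ^ n ≤ D) (n : ℕ) :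
    |u n - m⁻¹| ≤ D / (m * (1 - G)) * ρ⁻¹ ^ n := by
  have h := abs_sub_inv_mul_pow_le hr hu0 hf hf0 hren hf1 hm hmge hρ hG1 hG hD n
  have hρn : 0 < ρ ^ n := pow_pos hρ n
  rw [inv_pow, ← div_eq_mul_inv, le_div_iff₀ hρn]
  exact h

end Literature.Probability.Process.Renewal

namespace Literature.Probability.Process.Renewal

open Filter Topology

variable {u f : ℕ → ℝ}

/-- **Series form**: with the mean `m = Σ k f_k < ∞`, any `ρ ≥ 1`, `G = Σ_{j ≥ 1} r_j ρ^j < 1` and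
`H = Σ_{j ≥ 1} r_j (1 + ρ + ⋯ + ρ^{j-1}) < ∞`: `|uₙ - 1/m| ≤ H/(m(1-G)) · ρ^{-n}` for every `n` — an explicit form of the
exponential convergence `uₙ → 1/m` (Madras–Slade Theorem 4.2.5 gives `∃ ε > 0` by a residue argument).
[cite: MadrasSlade1993, Theorem 4.2.5 and Appendix B] -/
theorem abs_sub_inv_tsum_le (hu0 : u 0 = 1) (hf : ∀ k, 0 ≤ f k) (hf0 : f 0 = 0)
    (hren : ∀ n, 1 ≤ n → u n = ∑ k ∈ range (n + 1), f k * u (n - k)) (hf1 : HasSum f 1)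
    (hmean : Summable fun k : ℕ => (k : ℝ) * f k)
    {ρ G H : ℝ} (hρ : 1 ≤ ρ)
    (hG : HasSum (fun j : ℕ => (1 - ∑ k ∈ range (j + 2), f k) * ρ ^ (j + 1)) G) (hG1 : G < 1)
    (hH : HasSum (fun j : ℕ => (1 - ∑ k ∈ range (j + 2), f k) * ∑ l ∈ range (j + 1), ρ ^ l) H)
    (n : ℕ) :
    |u n - (∑' k : ℕ, (k : ℝ) * f k)⁻¹|
      ≤ H / ((∑' k : ℕ, (k : ℝ) * f k) * (1 - G)) * ρ⁻¹ ^ n := by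
  set r : ℕ → ℝ := fun k => 1 - ∑ i ∈ range (k + 1), f i with hrdef
  have hr : ∀ k, r k = 1 - ∑ i ∈ range (k + 1), f i := fun k => rfl
  set m : ℝ := ∑' k : ℕ, (k : ℝ) * f k with hmdef
  have hr0 : r 0 = 1 := tailSum_zero hr hf0
  have hrnn : ∀ k, 0 ≤ r k := fun k => tailSum_nonneg hr hf hf1 k
  have hmge : ∀ K, ∑ k ∈ range (K + 1), r k ≤ m := fun K =>
    sum_range_succ_tailSum_le_tsum hr hf hf1 hmean K
  have hm : 0 < m := by
    have h := hmge 0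
    simp [hr0] at h
    linarith
  have hρ0 : 0 < ρ := by linarith
  -- `r` is summable with sum `m`
  have hrsum : HasSum r m := by
    have ht := tendsto_sum_range_tailSum hr hf hf1 hmean
    have ht' : Tendsto (fun K => ∑ k ∈ range K, r k) atTop (𝓝 m) :=
      (tendsto_add_atTop_iff_nat 1).1 ht
    exact (hasSum_iff_tendsto_nat_of_nonneg hrnn m).2 ht'
  -- the finitary `G`-hypothesis
  have hGfin : ∀ N, ∑ k ∈ range N, r (k + 1) * ρ ^ (k + 1) ≤ G := by
    intro N
    exact sum_le_hasSum (range N) (fun k _ => mul_nonneg (hrnn _) (pow_nonneg hρ0.le _)) hG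
  -- the shifted `H`-series
  set g : ℕ → ℝ := fun j => (1 - ∑ k ∈ range (j + 2), f k) * ∑ l ∈ range (j + 1), ρ ^ l with hgdef
  have hgnn : ∀ j, 0 ≤ g j := fun j =>
    mul_nonneg (hrnn (j + 1)) (sum_nonneg fun l _ => pow_nonneg hρ0.le l)
  have hgs : Summable g := hH.summable
  -- the finitary `D`-hypothesis with `D = H`
  have hDfin : ∀ N, (m - ∑ k ∈ range (N + 1), r k) * ρ ^ N ≤ H := by
    intro N
    have htail : m - ∑ k ∈ range (N + 1), r k = ∑' k : ℕ, r (k + (N + 1)) := by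
      have := hrsum.summable.sum_add_tsum_nat_add (N + 1)
      rw [hrsum.tsum_eq] at this
      linarith
    rw [htail]
    have hshift : Summable fun k : ℕ => r (k + (N + 1)) :=
      (summable_nat_add_iff (N + 1)).2 hrsum.summable
    have hgshift : Summable fun k : ℕ => g (k + N) := (summable_nat_add_iff N).2 hgs
    rw [← tsum_mul_right]
    calc ∑' k : ℕ, r (k + (N + 1)) * ρ ^ N
        ≤ ∑' k : ℕ, g (k + N) := by
          refine Summable.tsum_le_tsum (fun k => ?_) (hshift.mul_right _) hgshift
          have hrk : r (k + (N + 1)) = 1 - ∑ i ∈ range (k + N + 2), f i := by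
            have e : k + (N + 1) + 1 = k + N + 2 := by omega
            rw [hr, e]
          have hgk : g (k + N) = (1 - ∑ i ∈ range (k + N + 2), f i) * ∑ l ∈ range (k + N + 1), ρ ^ l := by
            rw [hgdef]
          rw [hgk, ← hrk]
          refine mul_le_mul_of_nonneg_left ?_ (hrnn _)
          have hmem : N ∈ range (k + N + 1) := by simp
          exact single_le_sum (f := fun l => ρ ^ l) (fun l _ => pow_nonneg hρ0.le l) hmem
      _ ≤ ∑' j : ℕ, g j := by
          have h := hgs.sum_add_tsum_nat_add N
          have h0 : 0 ≤ ∑ j ∈ range N, g j := sum_nonneg fun j _ => hgnn j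
          linarith
      _ = H := hH.tsum_eq
  have h := abs_sub_inv_le hr hu0 hf hf0 hren hf1 hm hmge hρ0 hG1 hGfin hDfin n
  simpa [hmdef] using h

end Literature.Probability.Process.Renewal
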